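import Literature.NumberTheory.Rogawski1990.ArchTransfFamilySymmetries     -- ★ ED. 1 (LH7-p02 (g2)): `dense_regG`, `mem_closure_regG`, the periodicity kit, (P), (I₄); brings ★ `ArchTransfFamily` (`transfFam`, `bzExtendG`, `slotPerm`, `partnerPerms`)
import HarnessLib

/-!
# (W) for the candidate transfer family `transfFam`: the stable Weyl symmetry — flip half (re-labelling of the partner sum, `R_S`-twisted, extended across the `G`-walls by continuity)
# and real half (realised split reflection), with the three `Δ″`-identities at reflected chart points carried as hypotheses
# (Shelstad 1979 §4 p. 23 (II); Rogawski 1990 §4.3 (4.3.1) p. 43; Bouaziz 1994 §3.1 p. 579, §6.2 p. 591)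

Topic `NumberTheory/Rogawski1990`; namespace `Literature.NumberTheory.Rogawski1990`.  THEOREMS ONLY (no definition, no instance, no notation, no axiom, no named fact, no `sorry`).
Cell `pub/hodgecm-mathlib`, line LH3 (closer stub `stub_N9` — archimedean endoscopic transfer — of `Cruxes/H413/Lines/F0_U3LettersRung1.lean`, crux H413 = `stmt-HodgeConjecture-24833`):
organ **(L2-PWC)**, ED. 2 = the (W) conjunct (LH3-plan (g2) DEAL 2026-09-02T06:14:34Z; author LH7-p02 (g2)); sibling of ★ `ArchTransfFamilySymmetries` ((P), (I₄)).

THE MATHEMATICS.  (W) of ★ `ArchBzWeyl` has two halves.  FLIP (`w ∉ S`, the stably-realised `θ₀ ↔ θ₂`): on the partner sum the `H`-flip is a RE-LABELLING `ρ ↦ swap₀₂ ∘ ρ w` of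
`partnerPerms S` (an involution; `slotPerm_flipAt`), so the `G′`-readings are permuted among themselves and only the `H`-argument of `Δ″` moves — to the STABLY conjugate chart point
`endoTorus S (flipAt w c)`; with `Δ″` blind to that (`hΔflip`) and ★ `archRH_flipAt` (`R_S(flip c) = −e^{i(θ₀−θ₂)} R_S(c)`) one gets `transfFamReg S (flip c)·R_S(c) = R_S(flip c)·transfFamReg S c`
for EVERY `c` — NO clause of `F` is used.  REAL (`w ∈ S`, the realised `x_w ↦ −x_w`): a partner permutation is the identity at `w`, so it commutes with the reflection; both chart points move
to CONJUGATE ones (`hΔnegH`, `hΔnegG` — ★ `archExplicitDelta_conj_left`∕`_conj_right` once the atlases' conjugating elements are ★), `R_S`, `R′` are even (★ `archRH_negXAt`, `archRG_negXAt`)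
and `F S` is even ((W) of ★ `ArchHcWeyl`).  PASSAGE TO `transfFam = bzExtendG S (transfFamReg S)`: the real half is plain invariance under a homeomorphism preserving `RegG`, `InRegS` — ★
`bzExtendG_apply_homeomorph` transports it to EVERY point with no limit needed; the flip half is `R_S`-twisted, and at a pure `G`-wall point (all `x ≠ 0`, some `e^{iθ₁} = e^{iθ₀}` or
`e^{iθ₂}`) the ★ `bzExtendG` value is a `RegG`-LIMIT which a twisted identity does not transport when the limit fails to exist — so the flip half is stated under CONTINUITY of `transfFam S` on
`InRegS S` (O-L2's (I₁)): algebra on `RegG S`, then Mathlib `Set.EqOn.of_subset_closure` with ★ `dense_regG`; off `InRegS S` both sides vanish.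

WHAT IS PROVED.  §1 kit: `flipAt_apply_self_eq_swap`, `slotPerm_flipAt`, `update_swap_mem_partnerPerms`, `update_swap_update_swap`, `slotPerm_negXAt_of_eq_one`, `flipAt_mem_regG_iff`,
`negXAt_mem_regG_iff`, **`archRG_negXAt`**; §2 `transfFamReg_flipAt_mul_archRH (hΔflip)`, `transfFamReg_negXAt (hF) (hΔnegH) (hΔnegG)` (every `c`), `transfFam_negXAt` (every `c`),
`transfFam_flipAt_mul_archRH (hΔflip) (hcont)` and **`archBzWeyl_transfFam (hF : ArchHcWeyl (slotSign L α) F) (hΔflip) (hΔnegH) (hΔnegG) (hcont) : ArchBzWeyl (transfFam L α μ F)`**.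
HYPOTHESES NOT ★ (named for their dischargers): `hΔflip` ⟸ «`Δ″` is constant on stable classes of `γ_H`» (its ingredients `archTau`, `archWeylRatio`, `archKappaAt` read `ι(γ_H)`'s
`GL₃(L ⊗ ℝ)`-class) + the atlas' stable flip of `endoTorus`; `hΔnegH` ⟸ ★ `archExplicitDelta_conj_left` + the `H`-atlas' realised reflection (`endoTorus S (negXAt w c)` is `H_∞`-conjugate
to `endoTorus S c`); `hΔnegG` ⟸ ★ `archExplicitDelta_conj_right` + the `G′`-atlas' realised reflection (★ `boostStd_eq_conj_diagonal` is the germ); `hcont` ⟸ O-L2's (I₁).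
HONEST LABEL: HC_CM is proved only modulo the 7 printed citations (2 remaining: hLiu418 = stmt-HodgeConjecture-24832, h413 = stmt-HodgeConjecture-24833) until rung 0 closes; count-neutral.

## References
* [Shelstad1979] D. Shelstad, *Characters and inner forms of a quasi-split group over ℝ*, Compositio Math. 39 (1979), §4 p. 23 (condition (II): `Ψ(γ^ω) = det(ω) ξ_{ι−ω⁻¹ι}(γ) Ψ(γ)`),
  Lemma 4.2 p. 23.
* [Rogawski1990] J. D. Rogawski, *Automorphic Representations of Unitary Groups in Three Variables*, Ann. of Math. Stud. 123 (1990), §4.3 (4.3.1) p. 43, §8.2 p. 118.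
* [Bouaziz1994IntegralesOrbitales] A. Bouaziz, *Intégrales orbitales sur les groupes de Lie réductifs*, Ann. Sci. ÉNS 27 (1994), §3.1 p. 579, §6.2 p. 591.
-/

set_option autoImplicit false

noncomputable section

open NumberField NumberField.InfinitePlace Matrix Complex Set Filter Topology
open scoped MatrixGroups Matrix Classical Real
open Literature.NumberTheory.Automorphic Literature.NumberTheory.Automorphic.UnitaryGroup Literature.NumberTheory.Automorphic.ArchCartan
open Literature.NumberTheory.GaloisRepresentations

namespace Literature.NumberTheory.Rogawski1990

/-! ## §1–§2 (W): the stable Weyl symmetry of the candidate transfer family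

The `H`-flip `θ₀ ↔ θ₂` at a compact place `w ∉ S` RE-LABELS the partner sum (`ρ ↦ swap₀₂ ∘ ρ w`), so only the `H`-argument of `Δ″` moves — to a STABLY conjugate chart point; the
realised real reflection `x_w ↦ −x_w` at a split place moves both chart points to CONJUGATE ones.  The three `Δ″`-identities this needs are carried as HYPOTHESES (`hΔflip`, `hΔnegH`,
`hΔnegG`: dischargeable from «`Δ″` is constant on stable classes of `γ_H`» + the atlas' stable flip, resp. ★ `archExplicitDelta_conj_left`∕`_conj_right` + the atlases' realised
reflections — none of the three chart-level conjugacy lemmas is ★ yet); the flip half moreover needs CONTINUITY of `transfFam S` on `InRegS S` (the identity is algebra on `RegG S` and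
passes to the `G`-walls by density, §2 — at a pure `G`-wall point the ★ `bzExtendG` value is a `RegG`-limit and the `R_S`-twisted identity does not transport junk), which O-L2 has from
its (I₁).  The real half is unconditional in that respect (plain invariance IS transported by ★ `bzExtendG_apply_homeomorph`). -/

section WeylKit

variable {W : Type*} [Fintype W] [DecidableEq W]

omit [Fintype W] in
/-- The flip at `w` is the slot swap `(0 2)` at `w`: `flipAt w c w m = c w (swap 0 2 m)`. [cite: Shelstad1979, §4 p. 23] -/
theorem flipAt_apply_self_eq_swap (w : W) (c : W → Fin 3 → ℝ) (m : Fin 3) : flipAt w c w m = c w (Equiv.swap 0 2 m) := by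
  rw [flipAt_apply_self]
  fin_cases m
  · show c w 2 = c w (Equiv.swap 0 2 0); rw [Equiv.swap_apply_left]
  · show c w 1 = c w (Equiv.swap 0 2 1); rw [Equiv.swap_apply_of_ne_of_ne (by decide) (by decide)]
  · show c w 0 = c w (Equiv.swap 0 2 2); rw [Equiv.swap_apply_right]

omit [Fintype W] in
/-- **The `H`-flip re-labels the partner points**: `slotPerm ρ (flipAt w c) = slotPerm (update ρ w (swap 0 2 * ρ w)) c`. [cite: Shelstad1979, Lemma 4.2 (p. 23)] -/
theorem slotPerm_flipAt (ρ : W → Equiv.Perm (Fin 3)) (w : W) (c : W → Fin 3 → ℝ) :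
    slotPerm ρ (flipAt w c) = slotPerm (Function.update ρ w (Equiv.swap 0 2 * ρ w)) c := by
  funext v j
  simp only [slotPerm_apply]
  by_cases hv : v = w
  · subst hv
    rw [flipAt_apply_self_eq_swap, Function.update_self, Equiv.Perm.mul_apply]
  · rw [flipAt_apply_of_ne hv, Function.update_of_ne hv]

/-- The re-labelling `ρ ↦ update ρ w (swap 0 2 * ρ w)` preserves the partner permutations of a chart compact at `w`. [cite: Shelstad1979, Lemma 4.2 (p. 23)] -/
theorem update_swap_mem_partnerPerms {S : Finset W} {w : W} (hw : w ∉ S) {ρ : W → Equiv.Perm (Fin 3)} (hρ : ρ ∈ partnerPerms S) :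
    Function.update ρ w (Equiv.swap 0 2 * ρ w) ∈ partnerPerms S := by
  rw [mem_partnerPerms_iff] at hρ ⊢
  intro v hv
  have hvw : v ≠ w := fun h => hw (h ▸ hv)
  rw [Function.update_of_ne hvw]
  exact hρ v hv

omit [Fintype W] in
/-- The re-labelling is an involution (`swap 0 2` has order `2`). [cite: Shelstad1979, Lemma 4.2 (p. 23)] -/
theorem update_swap_update_swap (ρ : W → Equiv.Perm (Fin 3)) (w : W) :
    Function.update (Function.update ρ w (Equiv.swap 0 2 * ρ w)) w (Equiv.swap 0 2 * Function.update ρ w (Equiv.swap 0 2 * ρ w) w) = ρ := by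
  rw [Function.update_self, ← mul_assoc, Equiv.swap_mul_self, one_mul, Function.update_idem, Function.update_eq_self]

omit [Fintype W] in
/-- **At a split place a partner permutation commutes with the real reflection**: `slotPerm ρ (negXAt w c) = negXAt w (slotPerm ρ c)` when `ρ w = 1`.
[cite: Shelstad1979, Lemma 4.2 (p. 23)] -/
theorem slotPerm_negXAt_of_eq_one {ρ : W → Equiv.Perm (Fin 3)} {w : W} (h : ρ w = 1) (c : W → Fin 3 → ℝ) :
    slotPerm ρ (negXAt w c) = negXAt w (slotPerm ρ c) := by
  funext v j
  simp only [slotPerm_apply]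
  by_cases hv : v = w
  · subst hv
    rw [h, Equiv.Perm.coe_one, id, negXAt_apply_self, negXAt_apply_self]
    have h0 : slotPerm ρ c v = c v := slotPerm_apply_of_eq_one h c
    simp only [h0]
  · rw [negXAt_apply_of_ne hv, negXAt_apply_of_ne hv, slotPerm_apply]

omit [Fintype W] in
/-- **`RegG S` is flip-invariant at a compact place** (`w ∉ S`): injectivity of `i ↦ e^{i c w i}` is invariant under the slot swap. [cite: Bouaziz1994IntegralesOrbitales, §3.1 p. 579] -/
theorem flipAt_mem_regG_iff (S : Finset W) {w : W} (hw : w ∉ S) (c : W → Fin 3 → ℝ) : flipAt w c ∈ RegG S ↔ c ∈ RegG S := by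
  rw [mem_regG_iff, mem_regG_iff]
  refine and_congr (forall_congr' fun v => forall_congr' fun _ => ?_) (forall_congr' fun v => forall_congr' fun hv => ?_)
  · by_cases hvw : v = w
    · subst hvw
      have e : (fun i : Fin 3 => Circle.exp (flipAt v c v i)) = (fun i : Fin 3 => Circle.exp (c v i)) ∘ Equiv.swap 0 2 :=
        funext fun i => by rw [Function.comp_apply, flipAt_apply_self_eq_swap]
      rw [e]
      exact ⟨fun h => fun i j hij => (Equiv.swap (0 : Fin 3) 2).symm.injective (h (by simpa using hij)),
        fun h => h.comp (Equiv.swap (0 : Fin 3) 2).injective⟩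
    · rw [flipAt_apply_of_ne hvw]
  · have hvw : v ≠ w := fun h => hw (h ▸ hv)
    rw [flipAt_apply_of_ne hvw]

omit [Fintype W] in
/-- **`RegG S` is invariant under the real reflection at a split place** (`w ∈ S`). [cite: Bouaziz1994IntegralesOrbitales, §3.1 p. 579] -/
theorem negXAt_mem_regG_iff (S : Finset W) {w : W} (hw : w ∈ S) (c : W → Fin 3 → ℝ) : negXAt w c ∈ RegG S ↔ c ∈ RegG S := by
  rw [mem_regG_iff, mem_regG_iff]
  refine and_congr (forall_congr' fun v => forall_congr' fun hv => ?_) (forall_congr' fun v => forall_congr' fun _ => ?_)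
  · have hvw : v ≠ w := fun h => hv (h ▸ hw)
    rw [negXAt_apply_of_ne hvw]
  · by_cases hvw : v = w
    · subst hvw
      rw [negXAt_apply_self]
      show -c v 0 ≠ 0 ↔ c v 0 ≠ 0
      rw [neg_ne_zero]
    · rw [negXAt_apply_of_ne hvw]

/-- **Shelstad's `R′` on the `G′`-chart is EVEN in the split coordinate**: `archRG S′ (negXAt w c) = archRG S′ c` (`w ∈ S′`; the two complex-pair factors swap).
[cite: Shelstad1979, §4 p. 22] [cite: Rogawski1990, §8.2 p. 118] -/
theorem archRG_negXAt (S' : Finset W) {w : W} (hw : w ∈ S') (c : W → Fin 3 → ℝ) : archRG S' (negXAt w c) = archRG S' c := by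
  unfold archRG
  refine Finset.prod_congr rfl fun v _ => ?_
  by_cases hvw : v = w
  · subst hvw
    rw [if_pos hw, if_pos hw, negXAt_apply_self]
    simp only [Matrix.cons_val_zero, Matrix.cons_val_one, Matrix.cons_val_two, Matrix.head_cons, Matrix.tail_cons, neg_neg, Complex.ofReal_neg]
    rw [abs_sub_comm (Real.exp (-c v 0)) (Real.exp (c v 0)), mul_assoc, mul_assoc, mul_comm ‖Complex.exp (-↑(c v 0) + ↑(c v 2) * I) - Complex.exp (↑(c v 1) * I)‖]
  · rw [negXAt_apply_of_ne hvw]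

end WeylKit

section Weyl

variable (L : Type) [Field L] [NumberField L] [IsCMField L] (α : Fin 3 → L) (μ : HeckeCharacter L)
  (F : Finset {w : InfinitePlace L // IsComplex w} → ({w : InfinitePlace L // IsComplex w} → Fin 3 → ℝ) → ℂ)

/-- **FLIP HALF ON THE PARTNER SUM (every `c`)**: if `Δ″` does not see the (stably realised) `H`-flip of the chart point (`hΔflip`), then
`transfFamReg S (flipAt w c) · R_S(c) = R_S(flipAt w c) · transfFamReg S c` (`w ∉ S`): the flip re-labels the partner sum (`slotPerm_flipAt`, an involution of `partnerPerms S`) and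
multiplies `R_S` by the unit `−e^{i(θ₀−θ₂)}` (★ `archRH_flipAt`).  No clause of `F` is used. [cite: Shelstad1979, §4 p. 23] [cite: Rogawski1990, §4.3 (4.3.1) p. 43] -/
theorem transfFamReg_flipAt_mul_archRH
    (hΔflip : ∀ (S : Finset {w : InfinitePlace L // IsComplex w}) (w : {w : InfinitePlace L // IsComplex w}) (c : {w : InfinitePlace L // IsComplex w} → Fin 3 → ℝ)
      (γ' : ↥(arch (↥(maximalRealSubfield L)) L (IsCMField.complexConj L) 3 (Matrix.diagonal α))), w ∉ S →
      archExplicitDelta L (Matrix.diagonal α) (endoTorus L S (flipAt w c)) μ γ' = archExplicitDelta L (Matrix.diagonal α) (endoTorus L S c) μ γ')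
    (S : Finset {w : InfinitePlace L // IsComplex w}) {w : {w : InfinitePlace L // IsComplex w}} (hw : w ∉ S) (c : {w : InfinitePlace L // IsComplex w} → Fin 3 → ℝ) :
    transfFamReg L α μ F S (flipAt w c) * archRH S c = archRH S (flipAt w c) * transfFamReg L α μ F S c := by
  -- the partner sums at `flipAt w c` and at `c` coincide (re-labelling)
  have hsum : (∑ ρ ∈ partnerPerms S, archExplicitDelta L (Matrix.diagonal α) (endoTorus L S (flipAt w c)) μ (gprimeTorus L α S (slotPerm ρ (flipAt w c))) *
        (F S (slotPerm ρ (flipAt w c)) / archRG S (slotPerm ρ (flipAt w c)))) =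
      ∑ ρ ∈ partnerPerms S, archExplicitDelta L (Matrix.diagonal α) (endoTorus L S c) μ (gprimeTorus L α S (slotPerm ρ c)) * (F S (slotPerm ρ c) / archRG S (slotPerm ρ c)) := by
    refine Finset.sum_nbij' (fun ρ => Function.update ρ w (Equiv.swap 0 2 * ρ w)) (fun ρ => Function.update ρ w (Equiv.swap 0 2 * ρ w))
      (fun ρ hρ => update_swap_mem_partnerPerms hw hρ) (fun ρ hρ => update_swap_mem_partnerPerms hw hρ)
      (fun ρ _ => update_swap_update_swap ρ w) (fun ρ _ => update_swap_update_swap ρ w) (fun ρ _ => ?_)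
    rw [slotPerm_flipAt, hΔflip S w c _ hw]
  unfold transfFamReg
  rw [hsum, archRH_flipAt S hw c]
  ring

/-- **REAL HALF ON THE PARTNER SUM (every `c`)**: at a split place `w ∈ S`, if `Δ″` does not see the realised reflections of the two chart points (`hΔnegH` on the `H`-side, `hΔnegG` on the
`G′`-side — ★ `archExplicitDelta_conj_left`∕`_conj_right` + the atlases' conjugating elements) and `F S` is even in `x_w` ((W) of ★ `ArchHcWeyl`, real clause), then
`transfFamReg S (negXAt w c) = transfFamReg S c` (★ `archRH_negXAt`, `archRG_negXAt`, `slotPerm_negXAt_of_eq_one`). [cite: Shelstad1979, §4 p. 23] [cite: Rogawski1990, §4.3 (4.3.1) p. 43] -/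
theorem transfFamReg_negXAt (hF : ArchHcWeyl (slotSign L α) F)
    (hΔnegH : ∀ (S : Finset {w : InfinitePlace L // IsComplex w}) (w : {w : InfinitePlace L // IsComplex w}) (c : {w : InfinitePlace L // IsComplex w} → Fin 3 → ℝ)
      (γ' : ↥(arch (↥(maximalRealSubfield L)) L (IsCMField.complexConj L) 3 (Matrix.diagonal α))), w ∈ S →
      archExplicitDelta L (Matrix.diagonal α) (endoTorus L S (negXAt w c)) μ γ' = archExplicitDelta L (Matrix.diagonal α) (endoTorus L S c) μ γ')
    (hΔnegG : ∀ (S : Finset {w : InfinitePlace L // IsComplex w}) (w : {w : InfinitePlace L // IsComplex w}) (c : {w : InfinitePlace L // IsComplex w} → Fin 3 → ℝ)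
      (γH : ↥(arch (↥(maximalRealSubfield L)) L (IsCMField.complexConj L) 2 (Matrix.of fun i j : Fin 2 => if i.val + j.val + 1 = 2 then (1 : L) else 0)) ×
        ↥(arch (↥(maximalRealSubfield L)) L (IsCMField.complexConj L) 1 (Matrix.of fun i j : Fin 1 => if i.val + j.val + 1 = 1 then (1 : L) else 0))), w ∈ S →
      archExplicitDelta L (Matrix.diagonal α) γH μ (gprimeTorus L α S (negXAt w c)) = archExplicitDelta L (Matrix.diagonal α) γH μ (gprimeTorus L α S c))
    (S : Finset {w : InfinitePlace L // IsComplex w}) {w : {w : InfinitePlace L // IsComplex w}} (hw : w ∈ S) (c : {w : InfinitePlace L // IsComplex w} → Fin 3 → ℝ) :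
    transfFamReg L α μ F S (negXAt w c) = transfFamReg L α μ F S c := by
  unfold transfFamReg
  rw [archRH_negXAt S hw c]
  refine congrArg (fun s => archRH S c * partnerWeight L α S * s) (Finset.sum_congr rfl fun ρ hρ => ?_)
  rw [slotPerm_negXAt_of_eq_one (eq_one_of_mem_partnerPerms hρ hw), hΔnegH S w c _ hw, hΔnegG S w _ _ hw, archRG_negXAt S hw, hF.2 S _ w hw]

variable (S : Finset {w : InfinitePlace L // IsComplex w})

/-- **(W), REAL HALF for `transfFam`** (every `c`, no continuity needed): plain invariance under the homeomorphism `negXAt w` is transported by ★ `bzExtendG_apply_homeomorph`.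
[cite: Shelstad1979, §4 p. 23] [cite: Bouaziz1994IntegralesOrbitales, §3.1 p. 579] -/
theorem transfFam_negXAt (hF : ArchHcWeyl (slotSign L α) F)
    (hΔnegH : ∀ (S : Finset {w : InfinitePlace L // IsComplex w}) (w : {w : InfinitePlace L // IsComplex w}) (c : {w : InfinitePlace L // IsComplex w} → Fin 3 → ℝ)
      (γ' : ↥(arch (↥(maximalRealSubfield L)) L (IsCMField.complexConj L) 3 (Matrix.diagonal α))), w ∈ S →
      archExplicitDelta L (Matrix.diagonal α) (endoTorus L S (negXAt w c)) μ γ' = archExplicitDelta L (Matrix.diagonal α) (endoTorus L S c) μ γ')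
    (hΔnegG : ∀ (S : Finset {w : InfinitePlace L // IsComplex w}) (w : {w : InfinitePlace L // IsComplex w}) (c : {w : InfinitePlace L // IsComplex w} → Fin 3 → ℝ)
      (γH : ↥(arch (↥(maximalRealSubfield L)) L (IsCMField.complexConj L) 2 (Matrix.of fun i j : Fin 2 => if i.val + j.val + 1 = 2 then (1 : L) else 0)) ×
        ↥(arch (↥(maximalRealSubfield L)) L (IsCMField.complexConj L) 1 (Matrix.of fun i j : Fin 1 => if i.val + j.val + 1 = 1 then (1 : L) else 0))), w ∈ S →
      archExplicitDelta L (Matrix.diagonal α) γH μ (gprimeTorus L α S (negXAt w c)) = archExplicitDelta L (Matrix.diagonal α) γH μ (gprimeTorus L α S c))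
    {w : {w : InfinitePlace L // IsComplex w}} (hw : w ∈ S) (c : {w : InfinitePlace L // IsComplex w} → Fin 3 → ℝ) :
    transfFam L α μ F S (negXAt w c) = transfFam L α μ F S c :=
  bzExtendG_apply_homeomorph S (transfFamReg L α μ F S) (negXHomeomorph w) (fun x => negXAt_mem_regG_iff S hw x) (fun x => negXAt_mem_inRegS_iff S hw x)
    (fun a _ => transfFamReg_negXAt L α μ F hF hΔnegH hΔnegG S hw a) c

/-- **(W), FLIP HALF for `transfFam`** (every `c`), given CONTINUITY of `transfFam S` on `InRegS S` (O-L2's (I₁)): on `RegG S` it is `transfFamReg_flipAt_mul_archRH` literally; both sides are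
continuous on the open `InRegS S` ⊆ `closure (RegG S)` (§2), so the identity extends (Mathlib `Set.EqOn.of_subset_closure`); off `InRegS S` both values vanish.
[cite: Shelstad1979, §4 p. 23] [cite: Bouaziz1994IntegralesOrbitales, §3.1 p. 579; §6.2 p. 591] -/
theorem transfFam_flipAt_mul_archRH
    (hΔflip : ∀ (S : Finset {w : InfinitePlace L // IsComplex w}) (w : {w : InfinitePlace L // IsComplex w}) (c : {w : InfinitePlace L // IsComplex w} → Fin 3 → ℝ)
      (γ' : ↥(arch (↥(maximalRealSubfield L)) L (IsCMField.complexConj L) 3 (Matrix.diagonal α))), w ∉ S →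
      archExplicitDelta L (Matrix.diagonal α) (endoTorus L S (flipAt w c)) μ γ' = archExplicitDelta L (Matrix.diagonal α) (endoTorus L S c) μ γ')
    (hcont : ContinuousOn (transfFam L α μ F S) (InRegS S))
    {w : {w : InfinitePlace L // IsComplex w}} (hw : w ∉ S) (c : {w : InfinitePlace L // IsComplex w} → Fin 3 → ℝ) :
    transfFam L α μ F S (flipAt w c) * archRH S c = archRH S (flipAt w c) * transfFam L α μ F S c := by
  by_cases hci : c ∈ InRegS S
  · have key : EqOn (fun c => transfFam L α μ F S (flipAt w c) * archRH S c) (fun c => archRH S (flipAt w c) * transfFam L α μ F S c) (InRegS S) := by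
      refine Set.EqOn.of_subset_closure (s := RegG S) (fun x hx => ?_) ?_ ?_ (fun x hx => regS_subset_inRegS S (regG_subset_regS S hx)) (fun x _ => mem_closure_regG S x)
      · show transfFam L α μ F S (flipAt w x) * archRH S x = archRH S (flipAt w x) * transfFam L α μ F S x
        rw [transfFam_of_mem_regG L α μ F S ((flipAt_mem_regG_iff S hw x).2 hx), transfFam_of_mem_regG L α μ F S hx]
        exact transfFamReg_flipAt_mul_archRH L α μ F hΔflip S hw x
      · exact (hcont.comp (continuous_flipAt w).continuousOn fun x hx => (flipAt_mem_inRegS_iff S w x).2 hx).mul (continuous_archRH S).continuousOn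
      · exact ((continuous_archRH S).comp (continuous_flipAt w)).continuousOn.mul hcont
    exact key hci
  · rw [transfFam_of_not_mem_inRegS L α μ F S hci, transfFam_of_not_mem_inRegS L α μ F S (fun h => hci ((flipAt_mem_inRegS_iff S w c).1 h)), zero_mul,
      mul_zero]

/-- **(W) FOR THE CANDIDATE TRANSFER FAMILY** — `ArchBzWeyl (transfFam L α μ F)` from: (W) of `F` (★ `ArchHcWeyl`, real clause), the three `Δ″`-identities at reflected chart points
(`hΔflip`, `hΔnegH`, `hΔnegG` — see the module docstring: «`Δ″` constant on stable classes of `γ_H`» + the atlases' conjugating elements discharge them), and continuity of every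
`transfFam S` on `InRegS S` (O-L2's (I₁); needed for the flip half only). [cite: Shelstad1979, §4 p. 23] [cite: Bouaziz1994IntegralesOrbitales, §6.2 p. 591] -/
theorem archBzWeyl_transfFam (hF : ArchHcWeyl (slotSign L α) F)
    (hΔflip : ∀ (S : Finset {w : InfinitePlace L // IsComplex w}) (w : {w : InfinitePlace L // IsComplex w}) (c : {w : InfinitePlace L // IsComplex w} → Fin 3 → ℝ)
      (γ' : ↥(arch (↥(maximalRealSubfield L)) L (IsCMField.complexConj L) 3 (Matrix.diagonal α))), w ∉ S →
      archExplicitDelta L (Matrix.diagonal α) (endoTorus L S (flipAt w c)) μ γ' = archExplicitDelta L (Matrix.diagonal α) (endoTorus L S c) μ γ')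
    (hΔnegH : ∀ (S : Finset {w : InfinitePlace L // IsComplex w}) (w : {w : InfinitePlace L // IsComplex w}) (c : {w : InfinitePlace L // IsComplex w} → Fin 3 → ℝ)
      (γ' : ↥(arch (↥(maximalRealSubfield L)) L (IsCMField.complexConj L) 3 (Matrix.diagonal α))), w ∈ S →
      archExplicitDelta L (Matrix.diagonal α) (endoTorus L S (negXAt w c)) μ γ' = archExplicitDelta L (Matrix.diagonal α) (endoTorus L S c) μ γ')
    (hΔnegG : ∀ (S : Finset {w : InfinitePlace L // IsComplex w}) (w : {w : InfinitePlace L // IsComplex w}) (c : {w : InfinitePlace L // IsComplex w} → Fin 3 → ℝ)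
      (γH : ↥(arch (↥(maximalRealSubfield L)) L (IsCMField.complexConj L) 2 (Matrix.of fun i j : Fin 2 => if i.val + j.val + 1 = 2 then (1 : L) else 0)) ×
        ↥(arch (↥(maximalRealSubfield L)) L (IsCMField.complexConj L) 1 (Matrix.of fun i j : Fin 1 => if i.val + j.val + 1 = 1 then (1 : L) else 0))), w ∈ S →
      archExplicitDelta L (Matrix.diagonal α) γH μ (gprimeTorus L α S (negXAt w c)) = archExplicitDelta L (Matrix.diagonal α) γH μ (gprimeTorus L α S c))
    (hcont : ∀ S : Finset {w : InfinitePlace L // IsComplex w}, ContinuousOn (transfFam L α μ F S) (InRegS S)) :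
    ArchBzWeyl (transfFam L α μ F) :=
  ⟨fun S c _ hw => transfFam_flipAt_mul_archRH L α μ F S hΔflip (hcont S) hw c, fun S c _ hw => transfFam_negXAt L α μ F S hF hΔnegH hΔnegG hw c⟩

end Weyl



/-! ## §3 (ED. 2, append-only) PER-LABEL forms of the (W) clauses — hypotheses quantified at a FIXED `(S, w)` only

The global hypothesis `hΔnegG` of `archBzWeyl_transfFam` (quantified over EVERY label `S`) is unsatisfiable on a frame with a definite place: for `w ∈ S` OFF ★ `splitChartPlaces L α` the
★ `gprimeBlock` falls back to the compact chart and `negXAt` negates an ANGLE (LH3-plan (g2) finding 2026-09-02T06:34Z) — on such INADMISSIBLE labels the whole partner sum vanishes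
instead (no norm pair; the discharge file proves it).  The forms below take the `Δ″`-identities and the evenness of `F S` at ONE `(S, w)`, so that the (W)-assembly feeds them at the
ADMISSIBLE labels (★ `archExplicitDelta_endoTorus_flipAt`∕`_negXAt`, the `G′`-atlas' realised reflection) and treats the inadmissible ones separately. -/

section WeylAt

variable (L : Type) [Field L] [NumberField L] [IsCMField L] (α : Fin 3 → L) (μ : HeckeCharacter L)
  (F : Finset {w : InfinitePlace L // IsComplex w} → ({w : InfinitePlace L // IsComplex w} → Fin 3 → ℝ) → ℂ)
  (S : Finset {w : InfinitePlace L // IsComplex w}) {w : {w : InfinitePlace L // IsComplex w}}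

/-- **FLIP HALF ON THE PARTNER SUM AT ONE `(S, w)`** (`w ∉ S`, every `c`): `Δ″` blind to the `H`-flip of THIS chart's point (`hΔ`) ⇒
`transfFamReg S (flipAt w c) · R_S(c) = R_S(flipAt w c) · transfFamReg S c` (re-labelling `slotPerm_flipAt` + ★ `archRH_flipAt`; no clause of `F`). [cite: Shelstad1979, §4 p. 23] -/
theorem transfFamReg_flipAt_mul_archRH_at (hw : w ∉ S)
    (hΔ : ∀ (c : {w : InfinitePlace L // IsComplex w} → Fin 3 → ℝ) (γ' : ↥(arch (↥(maximalRealSubfield L)) L (IsCMField.complexConj L) 3 (Matrix.diagonal α))),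
      archExplicitDelta L (Matrix.diagonal α) (endoTorus L S (flipAt w c)) μ γ' = archExplicitDelta L (Matrix.diagonal α) (endoTorus L S c) μ γ')
    (c : {w : InfinitePlace L // IsComplex w} → Fin 3 → ℝ) :
    transfFamReg L α μ F S (flipAt w c) * archRH S c = archRH S (flipAt w c) * transfFamReg L α μ F S c := by
  have hsum : (∑ ρ ∈ partnerPerms S, archExplicitDelta L (Matrix.diagonal α) (endoTorus L S (flipAt w c)) μ (gprimeTorus L α S (slotPerm ρ (flipAt w c))) *
        (F S (slotPerm ρ (flipAt w c)) / archRG S (slotPerm ρ (flipAt w c)))) =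
      ∑ ρ ∈ partnerPerms S, archExplicitDelta L (Matrix.diagonal α) (endoTorus L S c) μ (gprimeTorus L α S (slotPerm ρ c)) * (F S (slotPerm ρ c) / archRG S (slotPerm ρ c)) := by
    refine Finset.sum_nbij' (fun ρ => Function.update ρ w (Equiv.swap 0 2 * ρ w)) (fun ρ => Function.update ρ w (Equiv.swap 0 2 * ρ w))
      (fun ρ hρ => update_swap_mem_partnerPerms hw hρ) (fun ρ hρ => update_swap_mem_partnerPerms hw hρ)
      (fun ρ _ => update_swap_update_swap ρ w) (fun ρ _ => update_swap_update_swap ρ w) (fun ρ _ => ?_)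
    rw [slotPerm_flipAt, hΔ c]
  unfold transfFamReg
  rw [hsum, archRH_flipAt S hw c]
  ring

/-- **REAL HALF ON THE PARTNER SUM AT ONE `(S, w)`** (`w ∈ S`, every `c`): evenness of `F S` in `x_w` (`hFS`) and `Δ″` blind to the realised reflections of THIS chart's two points
(`hΔH`, `hΔG` — meaningful for ADMISSIBLE `S`, i.e. `w ∈ splitChartPlaces L α`) ⇒ `transfFamReg S (negXAt w c) = transfFamReg S c`. [cite: Shelstad1979, §4 p. 23] -/
theorem transfFamReg_negXAt_at (hw : w ∈ S)
    (hFS : ∀ c : {w : InfinitePlace L // IsComplex w} → Fin 3 → ℝ, F S (negXAt w c) = F S c)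
    (hΔH : ∀ (c : {w : InfinitePlace L // IsComplex w} → Fin 3 → ℝ) (γ' : ↥(arch (↥(maximalRealSubfield L)) L (IsCMField.complexConj L) 3 (Matrix.diagonal α))),
      archExplicitDelta L (Matrix.diagonal α) (endoTorus L S (negXAt w c)) μ γ' = archExplicitDelta L (Matrix.diagonal α) (endoTorus L S c) μ γ')
    (hΔG : ∀ (c : {w : InfinitePlace L // IsComplex w} → Fin 3 → ℝ)
      (γH : ↥(arch (↥(maximalRealSubfield L)) L (IsCMField.complexConj L) 2 (Matrix.of fun i j : Fin 2 => if i.val + j.val + 1 = 2 then (1 : L) else 0)) ×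
        ↥(arch (↥(maximalRealSubfield L)) L (IsCMField.complexConj L) 1 (Matrix.of fun i j : Fin 1 => if i.val + j.val + 1 = 1 then (1 : L) else 0))),
      archExplicitDelta L (Matrix.diagonal α) γH μ (gprimeTorus L α S (negXAt w c)) = archExplicitDelta L (Matrix.diagonal α) γH μ (gprimeTorus L α S c))
    (c : {w : InfinitePlace L // IsComplex w} → Fin 3 → ℝ) :
    transfFamReg L α μ F S (negXAt w c) = transfFamReg L α μ F S c := by
  unfold transfFamReg
  rw [archRH_negXAt S hw c]
  refine congrArg (fun s => archRH S c * partnerWeight L α S * s) (Finset.sum_congr rfl fun ρ hρ => ?_)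
  rw [slotPerm_negXAt_of_eq_one (eq_one_of_mem_partnerPerms hρ hw), hΔH c, hΔG, archRG_negXAt S hw, hFS]

/-- **(W), REAL HALF for `transfFam` AT ONE `(S, w)`** (every `c`; plain invariance transported by ★ `bzExtendG_apply_homeomorph`). [cite: Shelstad1979, §4 p. 23]
[cite: Bouaziz1994IntegralesOrbitales, §3.1 p. 579] -/
theorem transfFam_negXAt_at (hw : w ∈ S)
    (hFS : ∀ c : {w : InfinitePlace L // IsComplex w} → Fin 3 → ℝ, F S (negXAt w c) = F S c)
    (hΔH : ∀ (c : {w : InfinitePlace L // IsComplex w} → Fin 3 → ℝ) (γ' : ↥(arch (↥(maximalRealSubfield L)) L (IsCMField.complexConj L) 3 (Matrix.diagonal α))),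
      archExplicitDelta L (Matrix.diagonal α) (endoTorus L S (negXAt w c)) μ γ' = archExplicitDelta L (Matrix.diagonal α) (endoTorus L S c) μ γ')
    (hΔG : ∀ (c : {w : InfinitePlace L // IsComplex w} → Fin 3 → ℝ)
      (γH : ↥(arch (↥(maximalRealSubfield L)) L (IsCMField.complexConj L) 2 (Matrix.of fun i j : Fin 2 => if i.val + j.val + 1 = 2 then (1 : L) else 0)) ×
        ↥(arch (↥(maximalRealSubfield L)) L (IsCMField.complexConj L) 1 (Matrix.of fun i j : Fin 1 => if i.val + j.val + 1 = 1 then (1 : L) else 0))),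
      archExplicitDelta L (Matrix.diagonal α) γH μ (gprimeTorus L α S (negXAt w c)) = archExplicitDelta L (Matrix.diagonal α) γH μ (gprimeTorus L α S c))
    (c : {w : InfinitePlace L // IsComplex w} → Fin 3 → ℝ) :
    transfFam L α μ F S (negXAt w c) = transfFam L α μ F S c :=
  bzExtendG_apply_homeomorph S (transfFamReg L α μ F S) (negXHomeomorph w) (fun x => negXAt_mem_regG_iff S hw x) (fun x => negXAt_mem_inRegS_iff S hw x)
    (fun a _ => transfFamReg_negXAt_at L α μ F S hw hFS hΔH hΔG a) c

/-- **(W), FLIP HALF for `transfFam` AT ONE `(S, w)`** (every `c`), given continuity of `transfFam S` on `InRegS S`: algebra on `RegG S`, density (★ `dense_regG`, Mathlib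
`Set.EqOn.of_subset_closure`) on `InRegS S`, `0 = 0` off it. [cite: Shelstad1979, §4 p. 23] [cite: Bouaziz1994IntegralesOrbitales, §3.1 p. 579; §6.2 p. 591] -/
theorem transfFam_flipAt_mul_archRH_at (hw : w ∉ S)
    (hΔ : ∀ (c : {w : InfinitePlace L // IsComplex w} → Fin 3 → ℝ) (γ' : ↥(arch (↥(maximalRealSubfield L)) L (IsCMField.complexConj L) 3 (Matrix.diagonal α))),
      archExplicitDelta L (Matrix.diagonal α) (endoTorus L S (flipAt w c)) μ γ' = archExplicitDelta L (Matrix.diagonal α) (endoTorus L S c) μ γ')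
    (hcont : ContinuousOn (transfFam L α μ F S) (InRegS S)) (c : {w : InfinitePlace L // IsComplex w} → Fin 3 → ℝ) :
    transfFam L α μ F S (flipAt w c) * archRH S c = archRH S (flipAt w c) * transfFam L α μ F S c := by
  by_cases hci : c ∈ InRegS S
  · have key : EqOn (fun c => transfFam L α μ F S (flipAt w c) * archRH S c) (fun c => archRH S (flipAt w c) * transfFam L α μ F S c) (InRegS S) := by
      refine Set.EqOn.of_subset_closure (s := RegG S) (fun x hx => ?_) ?_ ?_ (fun x hx => regS_subset_inRegS S (regG_subset_regS S hx)) (fun x _ => mem_closure_regG S x)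
      · show transfFam L α μ F S (flipAt w x) * archRH S x = archRH S (flipAt w x) * transfFam L α μ F S x
        rw [transfFam_of_mem_regG L α μ F S ((flipAt_mem_regG_iff S hw x).2 hx), transfFam_of_mem_regG L α μ F S hx]
        exact transfFamReg_flipAt_mul_archRH_at L α μ F S hw hΔ x
      · exact (hcont.comp (continuous_flipAt w).continuousOn fun x hx => (flipAt_mem_inRegS_iff S w x).2 hx).mul (continuous_archRH S).continuousOn
      · exact ((continuous_archRH S).comp (continuous_flipAt w)).continuousOn.mul hcont
    exact key hci
  · rw [transfFam_of_not_mem_inRegS L α μ F S hci, transfFam_of_not_mem_inRegS L α μ F S (fun h => hci ((flipAt_mem_inRegS_iff S w c).1 h)), zero_mul,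
      mul_zero]

end WeylAt

end Literature.NumberTheory.Rogawski1990

end
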